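import Literature.NumberTheory.Sieve.QuadraticRootsLevelGeometry
import HarnessLib

/-!
# The axis of an indefinite form: roots, the Cayley coordinate, and the Pell translation (`Δ > 0`)

Topic `Literature/NumberTheory/Sieve`, sixth file of the arithmetic trunk for the
Duke–Friedlander–Iwaniec / Tóth equidistribution theorems (`QuadraticRootsLevelForms.lean`, …,
`QuadraticRootsLevelGeometry.lean`), and the first one specific to Á. Tóth's positive-discriminant
case (IMRN 2000): the closed geodesics.  For an integral form `Q = [A, B, C]` with `A ≠ 0` and
`Δ = B² − 4AC > 0` the geodesic `S_Q = {A|z|² + B Re z + C = 0}` of `…LevelGeometry` joins the real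
roots `θ± = (−B ± √Δ)/(2A)` of `Q(x, 1)`; in the **Cayley coordinate**
`c_Q(z) = (z − θ₊)/(z − θ₋)` it becomes the imaginary axis, and the automorph `U(x, y)` of a Pell
solution `x² − Δy² = 1` acts as the dilation `c ↦ (x − y√Δ)² c`, i.e. as the translation by
`2 log (x + y√Δ)` along the axis — the period of the closed geodesic.  Everything here is proved
(elementary algebra over `ℝ`/`ℂ`):

* `rootPlus/rootMinus` and the Vieta relations (`eval_rootPlus`, `two_mul_a_mul_rootPlus`, …);
* `cayley Q z`, **`herm_eq_mul_re_cayley`** (`herm Q z = A |z − θ₋|² Re c_Q(z)`), `cayley_im`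
  (`Im c_Q(z) = (√Δ/A) Im z / |z − θ₋|²`), hence **`mem_geod_iff_re_cayley`**
  (`z ∈ S_Q ↔ Re c_Q(z) = 0`) and `cayley_im_pos` (`A > 0`: `c_Q` maps `ℍ` to `ℍ`);
* `pellUnit Q a = x + y√Δ`, `pellUnitInv Q a = x − y√Δ`, their product `1`, `1 < pellUnit` for the
  positive solutions;
* **`cayley_automorph_smul`**: `c_Q(U(x, y) • z) = (x − y√Δ)² · c_Q(z)` for `z ∈ ℍ` — the automorph
  translates along the axis (the factorisation `(pz + q) − θ(rz + s) = (x ∓ y√Δ)(z − θ)` at the two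
  fixed points `θ = θ±`, `fixed_factor_plus/minus`).

## References

* Á. Tóth, *Roots of quadratic congruences*, IMRN 2000, no. 14, 719–739 (positive discriminant:
  sums over closed geodesics; cite-only in the store — the role of the closed geodesics is as
  described in [cite: Ngo2024, §1]). [cite: Toth2000, main theorem]
* W. Duke, J. B. Friedlander, H. Iwaniec, Ann. of Math. (2) 141 (1995), §2 p. 427 (the
  negative-discriminant model of the construction). [cite: DukeFriedlanderIwaniec1995, §2 p. 427]
* P. Sarnak, *Class numbers of indefinite binary quadratic forms*, J. Number Theory 15 (1982),
  229–247, §1 (indefinite forms ↔ closed geodesics of length `2 log ε`; classical background, not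
  re-read here). [folklore]
-/

noncomputable section

namespace Literature.NumberTheory.Sieve

open scoped MatrixGroups UpperHalfPlane
open Literature.NumberTheory.QuadraticFields.Quadratic (BinQF)
open UpperHalfPlane

namespace RootForms

variable {Q : BinQF}

/-! ### The real roots of an indefinite form -/

/-- `√Δ` (as a real number; meaningful for `Δ ≥ 0`). [folklore] -/
def sqrtDisc (Q : BinQF) : ℝ := Real.sqrt Q.disc

/-- `(√Δ)² = Δ` for `Δ ≥ 0`. [folklore] -/
theorem sqrtDisc_sq (hΔ : 0 ≤ Q.disc) : sqrtDisc Q ^ 2 = Q.disc :=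
  Real.sq_sqrt (by exact_mod_cast hΔ)

/-- `√Δ > 0` for `Δ > 0`. [folklore] -/
theorem sqrtDisc_pos (hΔ : 0 < Q.disc) : 0 < sqrtDisc Q :=
  Real.sqrt_pos.2 (by exact_mod_cast hΔ)

/-- `(√Δ)² = B² − 4AC` written out. [folklore] -/
theorem sqrtDisc_sq' (hΔ : 0 ≤ Q.disc) : sqrtDisc Q ^ 2 = (Q.b : ℝ) ^ 2 - 4 * Q.a * Q.c := by
  rw [sqrtDisc_sq hΔ, BinQF.disc]; push_cast; ring

/-- The root `θ₊ = (−B + √Δ)/(2A)` of `Q(x, 1)`. [cite: Toth2000, main theorem (endpoints of the closed geodesics; cf. Ngo2024 §1)] -/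
def rootPlus (Q : BinQF) : ℝ := (-Q.b + sqrtDisc Q) / (2 * Q.a)

/-- The root `θ₋ = (−B − √Δ)/(2A)` of `Q(x, 1)`. [cite: Toth2000, main theorem (endpoints of the closed geodesics; cf. Ngo2024 §1)] -/
def rootMinus (Q : BinQF) : ℝ := (-Q.b - sqrtDisc Q) / (2 * Q.a)

/-- `2Aθ₊ = −B + √Δ`. [folklore] -/
theorem two_mul_a_mul_rootPlus (hA : Q.a ≠ 0) : 2 * Q.a * rootPlus Q = -Q.b + sqrtDisc Q := by
  have hA' : (Q.a : ℝ) ≠ 0 := by exact_mod_cast hA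
  rw [rootPlus]; field_simp

/-- `2Aθ₋ = −B − √Δ`. [folklore] -/
theorem two_mul_a_mul_rootMinus (hA : Q.a ≠ 0) : 2 * Q.a * rootMinus Q = -Q.b - sqrtDisc Q := by
  have hA' : (Q.a : ℝ) ≠ 0 := by exact_mod_cast hA
  rw [rootMinus]; field_simp

/-- `Aθ₊² + Bθ₊ + C = 0`. [folklore] -/
theorem eval_rootPlus (hA : Q.a ≠ 0) (hΔ : 0 ≤ Q.disc) :
    Q.a * rootPlus Q ^ 2 + Q.b * rootPlus Q + Q.c = 0 := by
  have hA' : (Q.a : ℝ) ≠ 0 := by exact_mod_cast hA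
  have h1 := two_mul_a_mul_rootPlus hA
  have h2 := sqrtDisc_sq' hΔ
  -- `4A(Aθ² + Bθ + C) = (2Aθ + B)² − Δ = (√Δ)² − Δ = 0`
  have h3 : 4 * (Q.a : ℝ) * (Q.a * rootPlus Q ^ 2 + Q.b * rootPlus Q + Q.c) = 0 := by
    linear_combination (2 * Q.a * rootPlus Q + Q.b + sqrtDisc Q) * h1 + h2
  have h4 : (4 * (Q.a : ℝ)) ≠ 0 := by positivity
  exact (mul_eq_zero.1 (by linear_combination h3)).resolve_left h4

/-- `Aθ₋² + Bθ₋ + C = 0`. [folklore] -/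
theorem eval_rootMinus (hA : Q.a ≠ 0) (hΔ : 0 ≤ Q.disc) :
    Q.a * rootMinus Q ^ 2 + Q.b * rootMinus Q + Q.c = 0 := by
  have hA' : (Q.a : ℝ) ≠ 0 := by exact_mod_cast hA
  have h1 := two_mul_a_mul_rootMinus hA
  have h2 := sqrtDisc_sq' hΔ
  have h3 : 4 * (Q.a : ℝ) * (Q.a * rootMinus Q ^ 2 + Q.b * rootMinus Q + Q.c) = 0 := by
    linear_combination (2 * Q.a * rootMinus Q + Q.b - sqrtDisc Q) * h1 + h2
  have h4 : (4 * (Q.a : ℝ)) ≠ 0 := by positivity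
  exact (mul_eq_zero.1 (by linear_combination h3)).resolve_left h4

/-- `θ₊ − θ₋ = √Δ/A`. [folklore] -/
theorem rootPlus_sub_rootMinus (hA : Q.a ≠ 0) : rootPlus Q - rootMinus Q = sqrtDisc Q / Q.a := by
  have hA' : (Q.a : ℝ) ≠ 0 := by exact_mod_cast hA
  rw [rootPlus, rootMinus]; field_simp; ring

/-- `θ₊ ≠ θ₋` for `Δ > 0`. [folklore] -/
theorem rootPlus_ne_rootMinus (hA : Q.a ≠ 0) (hΔ : 0 < Q.disc) : rootPlus Q ≠ rootMinus Q := by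
  intro h
  have h1 := rootPlus_sub_rootMinus hA
  rw [h, sub_self] at h1
  have hA' : (Q.a : ℝ) ≠ 0 := by exact_mod_cast hA
  have := sqrtDisc_pos hΔ
  field_simp at h1
  linarith

/-! ### The Cayley coordinate -/

/-- The **Cayley coordinate** `c_Q(z) = (z − θ₊)/(z − θ₋)` sending `θ₊ ↦ 0`, `θ₋ ↦ ∞` and the
geodesic `S_Q` onto the imaginary axis. [folklore] -/
def cayley (Q : BinQF) (z : ℂ) : ℂ := (z - rootPlus Q) / (z - rootMinus Q)

/-- `z − θ ≠ 0` for a real `θ` and `Im z ≠ 0`. [folklore] -/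
theorem sub_real_ne_zero {z : ℂ} (hz : z.im ≠ 0) (θ : ℝ) : z - (θ : ℂ) ≠ 0 := by
  intro h
  have := congrArg Complex.im h
  simp at this
  exact hz this

/-- `A(θ₊ + θ₋) = −B` (Vieta). [folklore] -/
theorem a_mul_root_sum (hA : Q.a ≠ 0) : (Q.a : ℝ) * (rootPlus Q + rootMinus Q) = -Q.b := by
  linear_combination (1 / 2 : ℝ) * two_mul_a_mul_rootPlus hA +
    (1 / 2 : ℝ) * two_mul_a_mul_rootMinus hA

/-- `Aθ₊θ₋ = C` (Vieta). [folklore] -/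
theorem a_mul_root_prod (hA : Q.a ≠ 0) (hΔ : 0 ≤ Q.disc) :
    (Q.a : ℝ) * (rootPlus Q * rootMinus Q) = Q.c := by
  have h4 : 4 * (Q.a : ℝ) * (Q.a * (rootPlus Q * rootMinus Q)) = 4 * Q.a * Q.c := by
    linear_combination (2 * Q.a * rootMinus Q) * two_mul_a_mul_rootPlus hA +
      (-Q.b + sqrtDisc Q) * two_mul_a_mul_rootMinus hA - sqrtDisc_sq' hΔ
  have hA' : (4 * (Q.a : ℝ)) ≠ 0 := by
    have : (Q.a : ℝ) ≠ 0 := by exact_mod_cast hA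
    positivity
  exact mul_left_cancel₀ hA' h4

/-- The real part of the Cayley coordinate. [folklore] -/
theorem cayley_re (z : ℂ) :
    (cayley Q z).re =
      ((z.re - rootPlus Q) * (z.re - rootMinus Q) + z.im * z.im) / Complex.normSq (z - rootMinus Q) := by
  rw [cayley, Complex.div_re]
  simp only [Complex.sub_re, Complex.sub_im, Complex.ofReal_re, Complex.ofReal_im, sub_zero]
  ring

/-- The imaginary part of the Cayley coordinate: `Im c_Q(z) = (θ₊ − θ₋) Im z / |z − θ₋|²`.
[folklore] -/
theorem cayley_im (z : ℂ) :
    (cayley Q z).im = (rootPlus Q - rootMinus Q) * z.im / Complex.normSq (z - rootMinus Q) := by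
  rw [cayley, Complex.div_im]
  simp only [Complex.sub_re, Complex.sub_im, Complex.ofReal_re, Complex.ofReal_im, sub_zero]
  ring

/-- **The geodesic in the Cayley coordinate**: `herm Q z = A · |z − θ₋|² · Re c_Q(z)`
(`Re((z − θ₊)(z̄ − θ₋)) = |z|² − (θ₊ + θ₋) Re z + θ₊θ₋ = herm Q z / A`). [folklore] -/
theorem herm_eq_mul_re_cayley (hA : Q.a ≠ 0) (hΔ : 0 ≤ Q.disc) {z : ℂ} (hz : z.im ≠ 0) :
    herm Q z = Q.a * Complex.normSq (z - rootMinus Q) * (cayley Q z).re := by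
  have hn : Complex.normSq (z - rootMinus Q) ≠ 0 :=
    (Complex.normSq_pos.2 (sub_real_ne_zero hz _)).ne'
  have hsum := a_mul_root_sum hA
  have hprod := a_mul_root_prod hA hΔ
  have e : (Q.a : ℝ) * Complex.normSq (z - rootMinus Q) *
      (((z.re - rootPlus Q) * (z.re - rootMinus Q) + z.im * z.im) / Complex.normSq (z - rootMinus Q)) =
      Q.a * ((z.re - rootPlus Q) * (z.re - rootMinus Q) + z.im * z.im) := by
    field_simp
  rw [cayley_re, e, herm, Complex.normSq_apply]
  linear_combination z.re * hsum - hprod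

/-- **`z ∈ S_Q ↔ Re c_Q(z) = 0`**: the geodesic of `Q` is the imaginary axis of the Cayley
coordinate (`A ≠ 0`, `Δ ≥ 0`). [cite: Toth2000, main theorem (closed geodesics; cf. Ngo2024 §1)] -/
theorem mem_geod_iff_re_cayley (hA : Q.a ≠ 0) (hΔ : 0 ≤ Q.disc) {z : ℍ} :
    z ∈ geod Q ↔ (cayley Q z).re = 0 := by
  have hz : (z : ℂ).im ≠ 0 := by rw [UpperHalfPlane.coe_im]; exact z.im_pos.ne'
  have hn : Complex.normSq ((z : ℂ) - rootMinus Q) ≠ 0 :=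
    (Complex.normSq_pos.2 (sub_real_ne_zero hz _)).ne'
  have hA' : (Q.a : ℝ) ≠ 0 := by exact_mod_cast hA
  rw [mem_geod, herm_eq_mul_re_cayley hA hΔ hz, mul_eq_zero, mul_eq_zero, or_iff_right]
  push Not
  exact ⟨hA', hn⟩

/-- For `A > 0`, `Δ > 0` the Cayley coordinate maps `ℍ` into `ℍ`. [folklore] -/
theorem cayley_im_pos (hA : 0 < Q.a) (hΔ : 0 < Q.disc) (z : ℍ) : 0 < (cayley Q z).im := by
  have hz : 0 < (z : ℂ).im := by rw [UpperHalfPlane.coe_im]; exact z.im_pos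
  have hn : 0 < Complex.normSq ((z : ℂ) - rootMinus Q) :=
    Complex.normSq_pos.2 (sub_real_ne_zero hz.ne' _)
  rw [cayley_im, rootPlus_sub_rootMinus hA.ne']
  have hA' : (0 : ℝ) < Q.a := by exact_mod_cast hA
  have := sqrtDisc_pos hΔ
  positivity

/-! ### The Pell unit and the translation along the axis -/

/-- The unit `ε = x + y√Δ` of a Pell solution. [folklore] -/
def pellUnit (Q : BinQF) (a : Pell.Solution₁ Q.disc) : ℝ := a.x + a.y * sqrtDisc Q

/-- Its conjugate `ε' = x − y√Δ = ε⁻¹`. [folklore] -/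
def pellUnitInv (Q : BinQF) (a : Pell.Solution₁ Q.disc) : ℝ := a.x - a.y * sqrtDisc Q

/-- `ε ε' = x² − Δy² = 1`. [folklore] -/
theorem pellUnit_mul_pellUnitInv (hΔ : 0 ≤ Q.disc) (a : Pell.Solution₁ Q.disc) :
    pellUnit Q a * pellUnitInv Q a = 1 := by
  have h : ((a.x : ℝ)) ^ 2 - (Q.disc : ℝ) * (a.y : ℝ) ^ 2 = 1 := by exact_mod_cast a.prop
  have h3 := sqrtDisc_sq hΔ
  rw [pellUnit, pellUnitInv]
  linear_combination h - ((a.y : ℝ)) ^ 2 * h3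

/-- `ε' ≠ 0`. [folklore] -/
theorem pellUnitInv_ne_zero (hΔ : 0 ≤ Q.disc) (a : Pell.Solution₁ Q.disc) : pellUnitInv Q a ≠ 0 := by
  intro h
  have := pellUnit_mul_pellUnitInv hΔ a
  rw [h, mul_zero] at this
  exact zero_ne_one this

/-- `ε ≠ 0`. [folklore] -/
theorem pellUnit_ne_zero (hΔ : 0 ≤ Q.disc) (a : Pell.Solution₁ Q.disc) : pellUnit Q a ≠ 0 := by
  intro h
  have := pellUnit_mul_pellUnitInv hΔ a
  rw [h, zero_mul] at this
  exact zero_ne_one this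

/-- For a positive solution (`x, y > 0`, `Δ > 0`) the unit satisfies `ε > 1`. [folklore] -/
theorem one_lt_pellUnit (hΔ : 0 < Q.disc) {a : Pell.Solution₁ Q.disc} (hx : 0 < a.x) (hy : 0 < a.y) :
    1 < pellUnit Q a := by
  rw [pellUnit]
  have hx1 : (1 : ℝ) ≤ a.x := by exact_mod_cast hx
  have hy0 : (0 : ℝ) < a.y := by exact_mod_cast hy
  have := sqrtDisc_pos hΔ
  nlinarith [mul_pos hy0 this]

/-- … and then `0 < ε' < 1`. [folklore] -/
theorem pellUnitInv_pos_lt_one (hΔ : 0 < Q.disc) {a : Pell.Solution₁ Q.disc} (hx : 0 < a.x)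
    (hy : 0 < a.y) : 0 < pellUnitInv Q a ∧ pellUnitInv Q a < 1 := by
  have h1 := one_lt_pellUnit hΔ hx hy
  have h2 := pellUnit_mul_pellUnitInv hΔ.le a
  have hpos : 0 < pellUnitInv Q a := by
    by_contra h
    push Not at h
    nlinarith
  refine ⟨hpos, ?_⟩
  nlinarith

/-- The automorph's action factorises at the fixed point `θ₊`:
`(pz + q) − θ₊(rz + s) = (x − y√Δ)(z − θ₊)` for `U(x, y) = (p q; r s)`. [folklore] -/
theorem fixed_factor_plus (hA : Q.a ≠ 0) (hΔ : 0 ≤ Q.disc) (a : Pell.Solution₁ Q.disc) (z : ℂ) :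
    (((a.x - Q.b * a.y : ℤ) : ℂ) * z + ((-(2 * Q.c * a.y) : ℤ) : ℂ)) -
        (rootPlus Q : ℂ) * ((((2 * Q.a * a.y : ℤ) : ℂ)) * z + ((a.x + Q.b * a.y : ℤ) : ℂ)) =
      (pellUnitInv Q a : ℂ) * (z - rootPlus Q) := by
  have h1 : 2 * (Q.a : ℂ) * (rootPlus Q : ℂ) = -(Q.b : ℂ) + (sqrtDisc Q : ℂ) := by
    have := congrArg (fun r : ℝ => (r : ℂ)) (two_mul_a_mul_rootPlus hA)
    push_cast at this
    exact this
  have h3 : (sqrtDisc Q : ℂ) ^ 2 = (Q.b : ℂ) ^ 2 - 4 * Q.a * Q.c := by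
    have := congrArg (fun r : ℝ => (r : ℂ)) (sqrtDisc_sq' hΔ)
    push_cast at this
    exact this
  have hA' : (2 * (Q.a : ℂ)) ≠ 0 := by
    have : (Q.a : ℂ) ≠ 0 := by exact_mod_cast hA
    exact mul_ne_zero two_ne_zero this
  rw [pellUnitInv]
  push_cast
  -- multiply by `2A` to stay polynomial
  apply mul_left_cancel₀ hA'
  linear_combination (-(2 * (Q.a : ℂ) * a.y * z) - a.y * (Q.b + sqrtDisc Q) + 2 * Q.a * a.y * rootPlus Q
    - 2 * Q.a * a.y * rootPlus Q) * h1 - (a.y : ℂ) * h3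

/-- The factorisation at the fixed point `θ₋`: `(pz + q) − θ₋(rz + s) = (x + y√Δ)(z − θ₋)`.
[folklore] -/
theorem fixed_factor_minus (hA : Q.a ≠ 0) (hΔ : 0 ≤ Q.disc) (a : Pell.Solution₁ Q.disc) (z : ℂ) :
    (((a.x - Q.b * a.y : ℤ) : ℂ) * z + ((-(2 * Q.c * a.y) : ℤ) : ℂ)) -
        (rootMinus Q : ℂ) * ((((2 * Q.a * a.y : ℤ) : ℂ)) * z + ((a.x + Q.b * a.y : ℤ) : ℂ)) =
      (pellUnit Q a : ℂ) * (z - rootMinus Q) := by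
  have h2 : 2 * (Q.a : ℂ) * (rootMinus Q : ℂ) = -(Q.b : ℂ) - (sqrtDisc Q : ℂ) := by
    have := congrArg (fun r : ℝ => (r : ℂ)) (two_mul_a_mul_rootMinus hA)
    push_cast at this
    exact this
  have h3 : (sqrtDisc Q : ℂ) ^ 2 = (Q.b : ℂ) ^ 2 - 4 * Q.a * Q.c := by
    have := congrArg (fun r : ℝ => (r : ℂ)) (sqrtDisc_sq' hΔ)
    push_cast at this
    exact this
  have hA' : (2 * (Q.a : ℂ)) ≠ 0 := by
    have : (Q.a : ℂ) ≠ 0 := by exact_mod_cast hA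
    exact mul_ne_zero two_ne_zero this
  rw [pellUnit]
  push_cast
  apply mul_left_cancel₀ hA'
  linear_combination (-(2 * (Q.a : ℂ) * a.y * z) - a.y * (Q.b - sqrtDisc Q)) * h2 - (a.y : ℂ) * h3

/-- **The automorph is a translation along the axis**: in the Cayley coordinate,
`c_Q(U(x, y) • z) = (x − y√Δ)² · c_Q(z)` for `z ∈ ℍ`; i.e. `U` moves points of `S_Q` (the imaginary
axis `c = it`) by the hyperbolic distance `|log (x − y√Δ)²| = 2 log(x + y√Δ)` — the period of the
closed geodesic attached to `Q` and the Pell solution `(x, y)`.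
[cite: Toth2000, main theorem (closed geodesics; cf. Ngo2024 §1)] -/
theorem cayley_automorph_smul (hA : Q.a ≠ 0) (hΔ : 0 ≤ Q.disc) (a : Pell.Solution₁ Q.disc) (z : ℍ) :
    cayley Q ((automorph Q a • z : ℍ) : ℂ) = (pellUnitInv Q a : ℂ) ^ 2 * cayley Q z := by
  have hD := denomZ_ne_zero (automorph Q a) z
  rw [coe_smul_eq]
  simp only [automorph_apply_00, automorph_apply_01, automorph_apply_10, automorph_apply_11] at hD ⊢
  set N : ℂ := ((a.x - Q.b * a.y : ℤ) : ℂ) * z + ((-(2 * Q.c * a.y) : ℤ) : ℂ) with hN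
  set D : ℂ := ((2 * Q.a * a.y : ℤ) : ℂ) * z + ((a.x + Q.b * a.y : ℤ) : ℂ) with hDdef
  have hz : (z : ℂ).im ≠ 0 := by rw [UpperHalfPlane.coe_im]; exact z.im_pos.ne'
  have hθm : (z : ℂ) - rootMinus Q ≠ 0 := sub_real_ne_zero hz _
  have hunit : (pellUnit Q a : ℂ) * (pellUnitInv Q a : ℂ) = 1 := by
    exact_mod_cast pellUnit_mul_pellUnitInv hΔ a
  have hε : (pellUnit Q a : ℂ) ≠ 0 := by exact_mod_cast pellUnit_ne_zero hΔ a
  have hnum : N - (rootPlus Q : ℂ) * D = (pellUnitInv Q a : ℂ) * (z - rootPlus Q) :=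
    fixed_factor_plus hA hΔ a z
  have hden : N - (rootMinus Q : ℂ) * D = (pellUnit Q a : ℂ) * (z - rootMinus Q) :=
    fixed_factor_minus hA hΔ a z
  have hden0 : N - (rootMinus Q : ℂ) * D ≠ 0 := by
    rw [hden]; exact mul_ne_zero hε hθm
  rw [cayley, cayley]
  rw [show N / D - (rootPlus Q : ℂ) = (N - (rootPlus Q : ℂ) * D) / D by field_simp,
    show N / D - (rootMinus Q : ℂ) = (N - (rootMinus Q : ℂ) * D) / D by field_simp,
    div_div_div_cancel_right₀ hD, hnum, hden, mul_div_mul_comm]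
  congr 1
  rw [div_eq_iff hε]
  linear_combination (-(pellUnitInv Q a : ℂ)) * hunit

end RootForms

end Literature.NumberTheory.Sieve
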